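import Summits.AtomisticToContinuum.HydrodynamicLimit.Theorems.OneFlightGossipEngineEnergyCurrentTailsFirstPartnerRung0MarkPositive
import Literature.Analysis.FluidPDE.HardSphereEuclideanScaling
import HarnessLib

/-!
# Crux `EnergyCurrentTails` (stmt-AtomisticToContinuum-9235), line `quartic-schur-ledger`:
# S5 `shareRung0_markPositive` of the RUNG-0 certificate of I′ `FirstPartnerRealisedShare`

Positivity of the Maxwellian mean of the sphere-integrated band mixing mark for GENERAL thresholds `K₀`,
`K₁ > 0`, band `K₂ = 3|K₀| + 3`: the general-threshold twin of `firstPartnerRung0_markPositive` of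
`…Theorems.OneFlightGossipEngineEnergyCurrentTailsFirstPartnerRung0MarkPositive` (there `K₀ = K₁ = 1`,
`K₂ = 3`), obtained from its zone lemmas by SCALING.

With `λ = |K₀| + 1 ≥ 1` (so `K₂ = 3λ`) the band mixing mark
`Ξ_K(ω, v, w) = [K₀ < ‖v‖ ≤ K₂] [‖w‖ ≤ K₁] · 2‖v′‖²‖w′‖²`, `(v′, w′) = reflectVel ω (v, w)`, is `4`-homogeneous
in the velocity pair (the reflection law is linear, `reflectVel_smul_pair`) and the hard-sphere kernel
`((w − v)·ω)₊` is `1`-homogeneous, so `Θ Ξ (λv, λw) = λ Θ Ξ^λ (v, w)` for the rescaled mark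
`Ξ^λ(ω, v, w) = Ξ(ω, λv, λw)` (`sphereMark_smul`).  On the rigid mixing zone of `bandMark_zone`
(`12/5 < ‖v‖ < 13/5`, `‖w‖ < 1/10`, cosine band `[13/20, 3/4]`) the rescaled cutoff `K₀ < λ‖v‖ ≤ 3λ` holds and
`Ξ^λ ≥ λ⁴ ≥ 1` once the partner cut is relaxed to `K₁' = max K₁ λ` (which does not change `Θ Ξ (v, w)` for
`‖w‖ < K₁`); hence `Θ Ξ_K ≥ λ · 2c_Z ≥ 2c_Z` on `B(λv₀, λ/10) × B(0, min(λ/10, K₁))`, `‖v₀‖ = 5/2`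
(`sphereMark_floor_of_zone`), two Lebesgue-non-null balls, and `integral_sphereMark_mul_maxwellian_pos`
concludes (`0 ≤ Ξ_K ≤ (K₂² + K₁²)²`, `Ξ_K = 0` at relative speed `≥ K₂ + K₁ + 1`).

References: C. Cercignani, R. Illner, M. Pulvirenti (1994) §2.2 (collision cylinder); Archimedes (hat-box).
-/

noncomputable section

open scoped BigOperators Classical ENNReal InnerProductSpace
open MeasureTheory Set Filter
open Literature.Analysis.FluidPDE Literature.MathematicalPhysics.KineticTheory
  Literature.MathematicalPhysics.StatisticalMechanics

namespace Summit.AtomisticToContinuum.HydrodynamicLimit.Theorems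

namespace QuarticSchurLedger

open EnergyCurrentTailsLevelCensus

/-! ## The band mixing mark `Ξ_K(ω, v, w) = [K₀ < ‖v‖ ≤ K₂] [‖w‖ ≤ K₁] · 2‖v′‖²‖w′‖²` with general thresholds -/

/-- The band mixing mark is measurable. [folklore] -/
private theorem measurable_bandMix {K₀ K₂ K₁ : ℝ} {Ξ : V3 × V3 × V3 → ℝ}
    (hΞ : Ξ = fun q => if K₀ < ‖q.2.1‖ ∧ ‖q.2.1‖ ≤ K₂ ∧ ‖q.2.2‖ ≤ K₁ then
      2 * (‖(reflectVel q.1 (q.2.1, q.2.2)).1‖ ^ 2 * ‖(reflectVel q.1 (q.2.1, q.2.2)).2‖ ^ 2) else 0) :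
    Measurable Ξ := by
  subst hΞ
  refine Measurable.ite ?_ ?_ measurable_const
  · have h1 : Measurable fun q : V3 × V3 × V3 => ‖q.2.1‖ := by fun_prop
    have h2 : Measurable fun q : V3 × V3 × V3 => ‖q.2.2‖ := by fun_prop
    exact (measurableSet_lt measurable_const h1).inter
      ((measurableSet_le h1 measurable_const).inter (measurableSet_le h2 measurable_const))
  · simp only [reflectVel]
    fun_prop

/-- The band mixing mark is nonnegative. [folklore] -/
private theorem bandMix_nonneg {K₀ K₂ K₁ : ℝ} {Ξ : V3 × V3 × V3 → ℝ}
    (hΞ : Ξ = fun q => if K₀ < ‖q.2.1‖ ∧ ‖q.2.1‖ ≤ K₂ ∧ ‖q.2.2‖ ≤ K₁ then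
      2 * (‖(reflectVel q.1 (q.2.1, q.2.2)).1‖ ^ 2 * ‖(reflectVel q.1 (q.2.1, q.2.2)).2‖ ^ 2) else 0)
    (p : V3 × V3 × V3) : 0 ≤ Ξ p := by
  subst hΞ
  dsimp only
  split_ifs
  · positivity
  · exact le_rfl

/-- The band mixing mark is bounded by `(K₂² + K₁²)²` (energy conservation of the reflection). [folklore] -/
private theorem bandMix_le {K₀ K₂ K₁ : ℝ} {Ξ : V3 × V3 × V3 → ℝ}
    (hΞ : Ξ = fun q => if K₀ < ‖q.2.1‖ ∧ ‖q.2.1‖ ≤ K₂ ∧ ‖q.2.2‖ ≤ K₁ then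
      2 * (‖(reflectVel q.1 (q.2.1, q.2.2)).1‖ ^ 2 * ‖(reflectVel q.1 (q.2.1, q.2.2)).2‖ ^ 2) else 0)
    (p : V3 × V3 × V3) : Ξ p ≤ (K₂ ^ 2 + K₁ ^ 2) ^ 2 := by
  subst hΞ
  dsimp only
  split_ifs with h
  · obtain ⟨-, h2, h3⟩ := h
    have he := norm_sq_reflectVel_fst_add_norm_sq_reflectVel_snd p.1 (p.2.1, p.2.2)
    dsimp only at he
    set x := ‖(reflectVel p.1 (p.2.1, p.2.2)).1‖ ^ 2
    set y := ‖(reflectVel p.1 (p.2.1, p.2.2)).2‖ ^ 2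
    have hv : ‖p.2.1‖ ^ 2 ≤ K₂ ^ 2 := pow_le_pow_left₀ (norm_nonneg _) h2 2
    have hw : ‖p.2.2‖ ^ 2 ≤ K₁ ^ 2 := pow_le_pow_left₀ (norm_nonneg _) h3 2
    have hxy : x + y ≤ K₂ ^ 2 + K₁ ^ 2 := by rw [he]; linarith
    have hx : 0 ≤ x := by positivity
    have hy : 0 ≤ y := by positivity
    have hxy0 : 0 ≤ x + y := add_nonneg hx hy
    nlinarith [sq_nonneg (x - y), mul_le_mul hxy hxy hxy0 (hxy0.trans hxy)]
  · positivity

/-- The band mixing mark vanishes at relative speed `≥ K₂ + K₁ + 1`. [folklore] -/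
private theorem bandMix_eq_zero_of_le {K₀ K₂ K₁ : ℝ} {Ξ : V3 × V3 × V3 → ℝ}
    (hΞ : Ξ = fun q => if K₀ < ‖q.2.1‖ ∧ ‖q.2.1‖ ≤ K₂ ∧ ‖q.2.2‖ ≤ K₁ then
      2 * (‖(reflectVel q.1 (q.2.1, q.2.2)).1‖ ^ 2 * ‖(reflectVel q.1 (q.2.1, q.2.2)).2‖ ^ 2) else 0)
    (m v v' : V3) (h : 2 * ((K₂ + K₁ + 1) / 2) ≤ ‖v - v'‖) : Ξ (m, v, v') = 0 := by
  subst hΞ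
  dsimp only
  rw [if_neg]
  rintro ⟨-, h2, h3⟩
  have := norm_sub_le v v'
  linarith

/-- Relaxing the partner cut to `K₁' ≥ K₁` does not change the mark at a partner of speed `≤ K₁`. [folklore] -/
private theorem bandMix_eq_of_norm_le {K₀ K₂ K₁ K₁' : ℝ} {Ξ Ξ₁ : V3 × V3 × V3 → ℝ}
    (hΞ : Ξ = fun q => if K₀ < ‖q.2.1‖ ∧ ‖q.2.1‖ ≤ K₂ ∧ ‖q.2.2‖ ≤ K₁ then
      2 * (‖(reflectVel q.1 (q.2.1, q.2.2)).1‖ ^ 2 * ‖(reflectVel q.1 (q.2.1, q.2.2)).2‖ ^ 2) else 0)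
    (hΞ₁ : Ξ₁ = fun q => if K₀ < ‖q.2.1‖ ∧ ‖q.2.1‖ ≤ K₂ ∧ ‖q.2.2‖ ≤ K₁' then
      2 * (‖(reflectVel q.1 (q.2.1, q.2.2)).1‖ ^ 2 * ‖(reflectVel q.1 (q.2.1, q.2.2)).2‖ ^ 2) else 0)
    (hK : K₁ ≤ K₁') {m v w : V3} (hw : ‖w‖ ≤ K₁) : Ξ (m, v, w) = Ξ₁ (m, v, w) := by
  subst hΞ hΞ₁
  simp only [hw, hw.trans hK, and_true]

/-- **`4`-homogeneity of the band mixing mark** (the reflection law is linear in the velocity pair,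
`reflectVel_smul_pair`): `Ξ_K(ω, c v, c w) = [K₀ < c‖v‖ ≤ K₂] [c‖w‖ ≤ K₁] · c⁴ · 2‖v′‖²‖w′‖²` for `c ≥ 0`.
[folklore] -/
private theorem bandMix_smul {K₀ K₂ K₁ : ℝ} {Ξ : V3 × V3 × V3 → ℝ}
    (hΞ : Ξ = fun q => if K₀ < ‖q.2.1‖ ∧ ‖q.2.1‖ ≤ K₂ ∧ ‖q.2.2‖ ≤ K₁ then
      2 * (‖(reflectVel q.1 (q.2.1, q.2.2)).1‖ ^ 2 * ‖(reflectVel q.1 (q.2.1, q.2.2)).2‖ ^ 2) else 0)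
    {c : ℝ} (hc : 0 ≤ c) (ω v w : V3) :
    Ξ (ω, c • v, c • w) = if K₀ < c * ‖v‖ ∧ c * ‖v‖ ≤ K₂ ∧ c * ‖w‖ ≤ K₁ then
      c ^ 4 * (2 * (‖(reflectVel ω (v, w)).1‖ ^ 2 * ‖(reflectVel ω (v, w)).2‖ ^ 2)) else 0 := by
  subst hΞ
  dsimp only
  have h := reflectVel_smul_pair ω c (v, w)
  rw [Prod.smul_mk] at h
  rw [norm_smul, norm_smul, Real.norm_of_nonneg hc, h, Prod.smul_fst, Prod.smul_snd, norm_smul,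
    norm_smul, Real.norm_of_nonneg hc]
  split_ifs
  · ring
  · rfl

/-! ## Scaling of the sphere-integrated mark -/

/-- **`1`-homogeneity of the hard-sphere flux**: `Θ Ξ (c v, c w) = c · Θ Ξ^c (v, w)` for `c ≥ 0`, where
`Ξ^c(ω, v, w) = Ξ(ω, c v, c w)` is the rescaled mark (`((cw − cv)·ω)₊ = c ((w − v)·ω)₊`). [folklore] -/
theorem sphereMark_smul (Ξ : V3 × V3 × V3 → ℝ) {c : ℝ} (hc : 0 ≤ c) (v w : V3) :
    sphereMark Ξ (c • v) (c • w) = c * sphereMark (fun q => Ξ (q.1, c • q.2.1, c • q.2.2)) v w := by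
  unfold sphereMark
  rw [← integral_const_mul]
  refine integral_congr_ae (ae_of_all _ fun ω => ?_)
  dsimp only
  have hk : hardSphereKernel (c • w, c • v) ω = c * hardSphereKernel (w, v) ω := by
    simp only [hardSphereKernel]
    rw [← smul_sub, real_inner_smul_left, mul_max_of_nonneg _ _ hc, mul_zero]
  rw [hk]
  ring

/-! ## The registered helper -/

/-- **S5 · positivity of the Maxwellian mean of the sphere-integrated band mixing mark, general thresholds
`K₀`, `K₁ > 0`, band `K₂ = 3|K₀| + 3`** (registered helper of the rung-0 certificate
`stub_firstPartnerRealisedShareRung0` of I′ `FirstPartnerRealisedShare`, line `quartic-schur-ledger`,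
stmt-AtomisticToContinuum-9235): for every `θ > 0`, drift `u`, `K₀` and `K₁ > 0`,
`0 < ∫∫ Θ Ξ_K (v, w) M_{1,u,θ}(v) M_{1,u,θ}(w)` for
`Ξ_K(ω, v, w) = 𝟙{K₀ < ‖v‖ ≤ 3|K₀| + 3, ‖w‖ ≤ K₁} · 2‖v′‖²‖w′‖²`, `(v′, w′) = reflectVel ω (v, w)`
(scaling by `λ = |K₀| + 1` of the zone lemmas of `firstPartnerRung0_markPositive`: `Θ Ξ_K ≥ 2 c_Z` on
`B(λv₀, λ/10) × B(0, min(λ/10, K₁))`, `‖v₀‖ = 5/2`). [folklore] -/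
theorem shareRung0_markPositive : ∀ (θ : ℝ) (u : V3) (K₀ K₁ : ℝ), 0 < θ → 0 < K₁ → 0 < ∫ p : V3 × V3, sphereMark (fun q : V3 × V3 × V3 => if K₀ < ‖q.2.1‖ ∧ ‖q.2.1‖ ≤ 3 * |K₀| + 3 ∧ ‖q.2.2‖ ≤ K₁ then 2 * (‖(reflectVel q.1 (q.2.1, q.2.2)).1‖ ^ 2 * ‖(reflectVel q.1 (q.2.1, q.2.2)).2‖ ^ 2) else 0) p.1 p.2 * (localMaxwellian 1 θ u p.1 * localMaxwellian 1 θ u p.2) := by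
  intro θ u K₀ K₁ hθ hK₁
  -- the scale `λ = |K₀| + 1`, the band `K₂ = 3λ`, the relaxed partner cut `K₁' = max K₁ λ`
  set lam : ℝ := |K₀| + 1 with hlam
  have habs : 0 ≤ |K₀| := abs_nonneg K₀
  have hlam1 : 1 ≤ lam := by rw [hlam]; linarith
  have hlam0 : 0 < lam := by linarith
  set K₂ : ℝ := 3 * |K₀| + 3 with hK₂
  have hK₂lam : K₂ = 3 * lam := by rw [hK₂, hlam]; ring
  set K₁' : ℝ := max K₁ lam with hK₁'
  -- the mark `Ξ` of the statement and its relaxed twin `Ξ₁` (partner cut `K₁'`)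
  set Ξ : V3 × V3 × V3 → ℝ := fun q : V3 × V3 × V3 => if K₀ < ‖q.2.1‖ ∧ ‖q.2.1‖ ≤ K₂ ∧ ‖q.2.2‖ ≤ K₁ then
    2 * (‖(reflectVel q.1 (q.2.1, q.2.2)).1‖ ^ 2 * ‖(reflectVel q.1 (q.2.1, q.2.2)).2‖ ^ 2) else 0 with hΞdef
  set Ξ₁ : V3 × V3 × V3 → ℝ := fun q : V3 × V3 × V3 => if K₀ < ‖q.2.1‖ ∧ ‖q.2.1‖ ≤ K₂ ∧ ‖q.2.2‖ ≤ K₁' then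
    2 * (‖(reflectVel q.1 (q.2.1, q.2.2)).1‖ ^ 2 * ‖(reflectVel q.1 (q.2.1, q.2.2)).2‖ ^ 2) else 0 with hΞ₁def
  -- the rescaled relaxed mark `Ξ^λ(ω, v, w) = Ξ₁(ω, λv, λw)` is `≥ 1` on the rigid mixing zone
  set Ξ' : V3 × V3 × V3 → ℝ := fun q => Ξ₁ (q.1, lam • q.2.1, lam • q.2.2) with hΞ'
  have hΞ'm : Measurable Ξ' :=
    (measurable_bandMix hΞ₁def).comp (by fun_prop : Measurable fun q : V3 × V3 × V3 =>
      ((q.1, lam • q.2.1, lam • q.2.2) : V3 × V3 × V3))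
  have hΞ'0 : ∀ p, 0 ≤ Ξ' p := fun p => bandMix_nonneg hΞ₁def _
  have hΞ'C : ∀ p, Ξ' p ≤ (K₂ ^ 2 + K₁' ^ 2) ^ 2 := fun p => bandMix_le hΞ₁def _
  have hΞ'1 : ∀ ω v w : V3, 12 / 5 < ‖v‖ → ‖v‖ < 13 / 5 → ‖w‖ < 1 / 10 → ‖ω‖ = 1 →
      13 / 20 ≤ ⟪‖w - v‖⁻¹ • (w - v), ω⟫_ℝ → ⟪‖w - v‖⁻¹ • (w - v), ω⟫_ℝ ≤ 3 / 4 → 1 ≤ Ξ' (ω, v, w) :=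
    fun ω v w hv1 hv2 hw hω h1 h2 => by
      simp only [hΞ']
      rw [bandMix_smul hΞ₁def hlam0.le]
      have hc1 : K₀ < lam * ‖v‖ :=
        calc K₀ ≤ |K₀| := le_abs_self K₀
          _ < lam := by rw [hlam]; linarith
          _ ≤ lam * ‖v‖ := le_mul_of_one_le_right hlam0.le (by linarith)
      have hc2 : lam * ‖v‖ ≤ K₂ := by
        rw [hK₂lam]
        nlinarith
      have hc3 : lam * ‖w‖ ≤ K₁' :=
        calc lam * ‖w‖ ≤ lam * 1 := mul_le_mul_of_nonneg_left (by linarith) hlam0.le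
          _ ≤ K₁' := by rw [mul_one]; exact le_max_right _ _
      rw [if_pos ⟨hc1, hc2, hc3⟩]
      have h4 : 1 ≤ lam ^ 4 := one_le_pow₀ hlam1
      nlinarith [bandMark_zone hv1 hv2 hw hω h1 h2]
  -- the two balls `B(λv₀, λ/10)`, `B(0, min(λ/10, K₁))` and the floor `2 c_Z`
  set v₀ : V3 := PiLp.single 2 (0 : Fin 3) (5 / 2 : ℝ) with hv₀
  have hn : ‖v₀‖ = 5 / 2 := by
    rw [hv₀, PiLp.norm_single, Real.norm_eq_abs, abs_of_pos (by norm_num)]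
  set cZ : ℝ := 2 * (volume ({p : EuclideanSpace ℝ (Fin 2) | 7 / 16 ≤ ‖p‖ ^ 2 ∧ ‖p‖ ^ 2 ≤ 231 / 400} ∩
    Metric.ball 0 1)).toReal with hcZdef
  have hcZ : 0 < cZ := mul_pos two_pos (ENNReal.toReal_pos zoneArea_pos.ne' zoneArea_lt_top.ne)
  have hfloor : ∀ v ∈ Metric.ball (lam • v₀) (lam / 10), ∀ w ∈ Metric.ball (0 : V3) (min (lam / 10) K₁),
      cZ ≤ sphereMark Ξ v w := by
    intro v hv w hw
    rw [Metric.mem_ball, dist_eq_norm] at hv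
    rw [mem_ball_zero_iff, lt_min_iff] at hw
    -- the rescaled points lie in the rigid zone
    have hv' : lam⁻¹ • v ∈ Metric.ball v₀ (1 / 10) := by
      rw [Metric.mem_ball, dist_eq_norm]
      have : lam⁻¹ • v - v₀ = lam⁻¹ • (v - lam • v₀) := by
        rw [smul_sub, inv_smul_smul₀ hlam0.ne']
      rw [this, norm_smul, norm_inv, Real.norm_of_nonneg hlam0.le, inv_mul_lt_iff₀ hlam0]
      linarith [hv]
    have hw' : lam⁻¹ • w ∈ Metric.ball (0 : V3) (1 / 10) := by
      rw [mem_ball_zero_iff, norm_smul, norm_inv, Real.norm_of_nonneg hlam0.le, inv_mul_lt_iff₀ hlam0]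
      linarith [hw.1]
    have hfl := sphereMark_floor_of_zone hΞ'm hΞ'0 hΞ'C hΞ'1 hn hv' hw'
    -- undo the relaxation of the partner cut and the scaling
    have hrel : sphereMark Ξ v w = lam * sphereMark Ξ' (lam⁻¹ • v) (lam⁻¹ • w) := by
      have h1 : sphereMark Ξ v w = sphereMark Ξ₁ v w := by
        unfold sphereMark
        refine integral_congr_ae (ae_of_all _ fun ω => ?_)
        dsimp only
        rw [bandMix_eq_of_norm_le hΞdef hΞ₁def (le_max_left K₁ lam) hw.2.le]
      rw [h1, hΞ', ← sphereMark_smul Ξ₁ hlam0.le, smul_inv_smul₀ hlam0.ne', smul_inv_smul₀ hlam0.ne']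
    rw [hrel]
    calc cZ = 1 * cZ := (one_mul _).symm
      _ ≤ lam * sphereMark Ξ' (lam⁻¹ • v) (lam⁻¹ • w) := mul_le_mul hlam1 hfl hcZ.le hlam0.le
  -- conclusion
  have hL : (0 : ℝ) ≤ (K₂ + K₁ + 1) / 2 := by
    rw [hK₂]
    linarith
  exact integral_sphereMark_mul_maxwellian_pos (measurable_bandMix hΞdef) (bandMix_nonneg hΞdef)
    (fun p => by rw [abs_of_nonneg (bandMix_nonneg hΞdef p)]; exact bandMix_le hΞdef p) hL
    (bandMix_eq_zero_of_le hΞdef) measurableSet_ball measurableSet_ball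
    (Metric.measure_ball_pos volume (lam • v₀) (by positivity : (0 : ℝ) < lam / 10)).ne'
    (Metric.measure_ball_pos volume (0 : V3) (lt_min (by positivity) hK₁)).ne' hcZ hfloor hθ u

end QuarticSchurLedger

end Summit.AtomisticToContinuum.HydrodynamicLimit.Theorems

end
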